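import Summits.BirchSwinnertonDyer.Rank1Residual.X2.GreenbergVatsalIsogenyReduction
import HarnessLib

/-!
# Sub-cell X2a (`X2.TargetA`) and the class statement of record for X2 from registered facts, the two
# typed GV inputs at CASE-1 data, and Cassels — WITHOUT the flag `GV00-mult-asserted`
# (cell `b2b-bsdres`, unit `b2b-bsdres-eisenstein-p2`, gen 18)

HONEST FRAMING (run/shared/lean/b2b/bsd-rank1-residual/, verbatim in every file): the goal of the
cell is to DELETE the COMBINATION-SHAPED residual classes of the Birch–Swinnerton-Dyer formula for
ALL analytic-rank `≤ 1` elliptic curves over `ℚ` — "full BSD formula for every rank `≤ 1` curve in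
class `C`" assembled STRICTLY from published theorems — so that the rank-`≤ 1` remainder becomes
exactly the CONSTRUCTION-SHAPED classes, which are TYPED (missing-input `Prop`s), NOT attempted.
This is not "finishing BSD". Research route; NO CLAIM BEYOND STATED CLASSES; nothing here changes
a label (the seat proposes, the referee rules). Theorems only; no definition, no named fact.

WHAT. The packaging of `X2/GreenbergVatsalIsogenyReduction.lean` (`bsdp_of_gvPar_rankZero`: both
parity cases of an X2a pair, CASE 2 through GV's isogeny `E → E/Φ₀` and Cassels):

* `targetA_of_inputs` — **`X2.TargetA`** (`BSD(E,p)` on every X2a pair `r_an = 0 ∧ ClassX2 ∧ GVPar`)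
  from the registered published named facts in the binders (Tate uniformisation A40/A41, GV §1–§2
  facts A133/A135/A137, Greenberg 1999 Prop. 5.10, Wuthrich 2014 Thm. 16, Stein–Wuthrich 2013
  Thm. 6.1 + §4.2, Greenberg–Stevens, GZK, modularity, Cassels) and the two TYPED printed GV inputs
  `X2.GVLiftingInput` (GV p. 28/30) / `X2.GVAnalyticInput` (GV Thm. (3.11) + (28) + p. 43) at every
  admissible CASE-1 datum — compare `X2.RankZero.targetA_of_published`, whose first binder is
  `lambdaMu_multiplicative_of_gvPar` (A63/A64, flag `GV00-mult-asserted`);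
* `mazurMainConjectureAt_of_gvPar_of_inputs_rankZero` — Mazur's main conjecture at every X2a pair
  (both parity cases) by the cell's exact converse `X2.mazurMainConjectureAt_of_bsdp_of_red`
  (`RankZeroExact`); in CASE 2 this realises GV's "the `λ`-invariant is always unchanged by an
  isogeny" through `BSD(E,p)`;
* `target_of_inputs_of_missingInputs` — the class statement of record `X2.Target` from these inputs
  and the typed missing inputs of the CONSTRUCTION-SHAPED sub-cells X2b / X2c (shape of
  `X2.RankZero.target_of_published_of_missingInputs`).

References: [GreenbergVatsal2000] Thm. (1.3), §2 p. 28, §3 Thm. (3.11); [Wuthrich2014] Thm. 16;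
[MilneADT2006] Thm. I.7.3; [Miller2011LMS] Def. 1.1; HOME/b2b-bsdres-eisenstein-p2/X2-GAP.md §23.
-/

set_option autoImplicit false

noncomputable section

open scoped Classical MatrixGroups ModularForm

open PowerSeries NumberField IsDedekindDomain Field WeierstrassCurve CongruenceSubgroup
  Literature.NumberTheory.EllipticCurves Literature.NumberTheory.EllipticCurves.GreenbergVatsal2000
  Literature.NumberTheory.EllipticCurves.ModularForms
  Literature.NumberTheory.EllipticCurves.Wuthrich2014
  Literature.NumberTheory.EllipticCurves.SteinWuthrich2013
  Literature.NumberTheory.EllipticCurves.Rank1Residual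
  Literature.NumberTheory.EllipticCurves.Rank1Residual.Typed
  Summit.BirchSwinnertonDyer.Rank1Residual.X2.GreenbergVatsalIsogenyReduction

namespace Summit.BirchSwinnertonDyer.Rank1Residual.X2.GreenbergVatsalTargetAOfInputs

/-! ## Sub-cell X2a and the class statement of record, without `GV00-mult-asserted` -/

/-- **`X2.TargetA` WITHOUT the flag's named fact**: `BSD(E,p)` on every X2a pair
(`r_an = 0 ∧ ClassX2 ∧ GVPar`) from the registered published named facts in the binders (Tate
uniformisation A40/A41, GV §1–§2 facts A133/A135/A137, Greenberg 1999 Prop. 5.10, Wuthrich 2014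
Thm. 16, Stein–Wuthrich 2013 Thm. 6.1 + §4.2, Greenberg–Stevens, GZK, modularity, Cassels) and the
two TYPED printed GV inputs `X2.GVLiftingInput` (GV p. 28/30) / `X2.GVAnalyticInput` (GV Thm. (3.11)
+ (28) + p. 43) at every admissible CASE-1 datum. Compare `X2.RankZero.targetA_of_published`, whose
first binder is `lambdaMu_multiplicative_of_gvPar` (flag `GV00-mult-asserted`).
[cite: GreenbergVatsal2000, Thm. (1.3), §2 (16) and p. 28, §3 Thm. (3.11)]
[cite: Wuthrich2014, Thm. 16 (p. 397)] [cite: MilneADT2006, Thm. I.7.3] -/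
theorem targetA_of_inputs
    (hT : Silverman1994_thmV53_tateUniformisation.{0})
    (hT' : Silverman1994_thmV53_corV54_tateUniformisation.{0})
    (hA : lambda_nonPrimitive_eq_add_sum_delta_multiplicative)
    (hB : datumSelmer_divisible_of_finite_torsionBy)
    (hF : datumStrictSelmer_lt_datumSelmer_of_split)
    (hG : Greenberg1999.prop510_isTorsion_hasUnitContent_of_gvPar)
    (hLift : ∀ (W : WeierstrassCurve ℚ) [W.IsGloballyMinimal] [W.IsElliptic] (p : ℕ) [Fact p.Prime]
      (κ : ZpExtension ℚ p) (S₀ : Finset (HeightOneSpectrum (𝓞 ℚ)))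
      (Φ₀ : AddSubgroup (W.geomTorsion (p : ℤ))) (hΦ : IsRationalLine W p Φ₀),
      p ≠ 2 → κ.IsCyclotomic → ¬ LineUnramifiedAt W p Φ₀ → LineEven W p Φ₀ →
      (∀ v ∈ S₀, ((p : ℕ) : 𝓞 ℚ) ∉ v.asIdeal) →
      (∀ v : HeightOneSpectrum (𝓞 ℚ), v ∉ S₀ → ((p : ℕ) : 𝓞 ℚ) ∉ v.asIdeal →
        W.HasGoodReductionAt v) →
      GVLiftingInput W p κ S₀ Φ₀ hΦ)
    (hAn : ∀ (W : WeierstrassCurve ℚ) [W.IsGloballyMinimal] [W.IsElliptic] (p : ℕ) [Fact p.Prime]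
      (κ : ZpExtension ℚ p) {N : ℕ} [NeZero N] (f : CuspForm (Gamma0 N) 2)
      (S₀ : Finset (HeightOneSpectrum (𝓞 ℚ)))
      (Φ₀ : AddSubgroup (W.geomTorsion (p : ℤ))) (hΦ : IsRationalLine W p Φ₀),
      p ≠ 2 → W.HasMultiplicativeReductionAtPrime p → κ.IsCyclotomic →
      ¬ LineUnramifiedAt W p Φ₀ → LineEven W p Φ₀ → IsNewformOf W f →
      (∀ v ∈ S₀, ((p : ℕ) : 𝓞 ℚ) ∉ v.asIdeal) →
      (∀ v : HeightOneSpectrum (𝓞 ℚ), v ∉ S₀ → ((p : ℕ) : 𝓞 ℚ) ∉ v.asIdeal →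
        W.HasGoodReductionAt v) →
      GVAnalyticInput W p κ f S₀ Φ₀ hΦ)
    (hWu : thm16_charIdeal_dvd_multiplicative_of_reducible)
    (hJs : thm61_splitMultiplicative) (hJn : thm61_nonsplitMultiplicative)
    (hHs : exists_isSplitMultCanonical) (hHn : exists_isMultCanonical)
    (hGZK : rank_eq_analyticRank_of_analyticRank_le_one) (hmod : hasEntireLFunction_rat)
    (hpar : nonempty_modularParametrizationData)
    (hCassels : bsdRHS_eq_of_isIsogenous)
    (hGS : ∀ (W : WeierstrassCurve ℚ) [W.IsElliptic] [W.IsGloballyMinimal] (p : ℕ) [Fact p.Prime],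
      greenberg_stevens (W := W) (p := p)) :
    TargetA := by
  intro W _ _ p _ hc
  obtain ⟨hr, ⟨hp, -, hmult⟩, hgv⟩ := hc
  exact bsdp_of_gvPar_rankZero hT hT' hA hB hF hG hLift hAn hWu hJs hJn hHs hHn hGZK hmod hpar hCassels
    hGS W p hp hmult hr hgv

/-- **Mazur's main conjecture at every X2a pair, without the flag** (both parity cases): at
`r_an = 0` and an odd multiplicative Eisenstein prime, `BSD(E,p) ⟹ X2.MazurMainConjectureAt W p`
is the cell's exact converse (`X2.mazurMainConjectureAt_of_bsdp_of_red`, Wuthrich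
Thm. 16 + the rank-`0` glue), applied to `bsdp_of_gvPar_rankZero`. In CASE 2 this is GV's
"the `λ`-invariant is always unchanged by an isogeny" obtained through `BSD(E,p)` rather than
through the Selmer groups. [cite: GreenbergVatsal2000, Thm. (1.3) and §2 p. 28]
[cite: Wuthrich2014, Thm. 16 (p. 397)] -/
theorem mazurMainConjectureAt_of_gvPar_of_inputs_rankZero
    (hT : Silverman1994_thmV53_tateUniformisation.{0})
    (hT' : Silverman1994_thmV53_corV54_tateUniformisation.{0})
    (hA : lambda_nonPrimitive_eq_add_sum_delta_multiplicative)
    (hB : datumSelmer_divisible_of_finite_torsionBy)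
    (hF : datumStrictSelmer_lt_datumSelmer_of_split)
    (hG : Greenberg1999.prop510_isTorsion_hasUnitContent_of_gvPar)
    (hLift : ∀ (W : WeierstrassCurve ℚ) [W.IsGloballyMinimal] [W.IsElliptic] (p : ℕ) [Fact p.Prime]
      (κ : ZpExtension ℚ p) (S₀ : Finset (HeightOneSpectrum (𝓞 ℚ)))
      (Φ₀ : AddSubgroup (W.geomTorsion (p : ℤ))) (hΦ : IsRationalLine W p Φ₀),
      p ≠ 2 → κ.IsCyclotomic → ¬ LineUnramifiedAt W p Φ₀ → LineEven W p Φ₀ →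
      (∀ v ∈ S₀, ((p : ℕ) : 𝓞 ℚ) ∉ v.asIdeal) →
      (∀ v : HeightOneSpectrum (𝓞 ℚ), v ∉ S₀ → ((p : ℕ) : 𝓞 ℚ) ∉ v.asIdeal →
        W.HasGoodReductionAt v) →
      GVLiftingInput W p κ S₀ Φ₀ hΦ)
    (hAn : ∀ (W : WeierstrassCurve ℚ) [W.IsGloballyMinimal] [W.IsElliptic] (p : ℕ) [Fact p.Prime]
      (κ : ZpExtension ℚ p) {N : ℕ} [NeZero N] (f : CuspForm (Gamma0 N) 2)
      (S₀ : Finset (HeightOneSpectrum (𝓞 ℚ)))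
      (Φ₀ : AddSubgroup (W.geomTorsion (p : ℤ))) (hΦ : IsRationalLine W p Φ₀),
      p ≠ 2 → W.HasMultiplicativeReductionAtPrime p → κ.IsCyclotomic →
      ¬ LineUnramifiedAt W p Φ₀ → LineEven W p Φ₀ → IsNewformOf W f →
      (∀ v ∈ S₀, ((p : ℕ) : 𝓞 ℚ) ∉ v.asIdeal) →
      (∀ v : HeightOneSpectrum (𝓞 ℚ), v ∉ S₀ → ((p : ℕ) : 𝓞 ℚ) ∉ v.asIdeal →
        W.HasGoodReductionAt v) →
      GVAnalyticInput W p κ f S₀ Φ₀ hΦ)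
    (hWu : thm16_charIdeal_dvd_multiplicative_of_reducible)
    (hJs : thm61_splitMultiplicative) (hJn : thm61_nonsplitMultiplicative)
    (hHs : exists_isSplitMultCanonical) (hHn : exists_isMultCanonical)
    (hGZK : rank_eq_analyticRank_of_analyticRank_le_one) (hmod : hasEntireLFunction_rat)
    (hpar : nonempty_modularParametrizationData)
    (hCassels : bsdRHS_eq_of_isIsogenous)
    (hGS : ∀ (W : WeierstrassCurve ℚ) [W.IsElliptic] [W.IsGloballyMinimal] (p : ℕ) [Fact p.Prime],
      greenberg_stevens (W := W) (p := p))
    (W : WeierstrassCurve ℚ) [W.IsElliptic] [W.IsGloballyMinimal] (p : ℕ) [Fact p.Prime]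
    (hp : p ≠ 2) (hmult : W.HasMultiplicativeReductionAtPrime p) (hr : W.analyticRank = 0)
    (hgv : GVPar W p) : MazurMainConjectureAt W p := by
  have hred : ¬ W.HasIrreducibleModPGaloisRep p := by
    obtain ⟨Φ, hΦ, -⟩ := hgv
    exact not_hasIrreducibleModPGaloisRep_of_isRationalLine hΦ
  exact mazurMainConjectureAt_of_bsdp_of_red hWu hJs hJn hHs hHn hGZK hmod W p (hGS W p)
    hp hmult hred hr
    (bsdp_of_gvPar_rankZero hT hT' hA hB hF hG hLift hAn hWu hJs hJn hHs hHn hGZK hmod hpar hCassels hGS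
      W p hp hmult hr hgv)

/-- **The class statement of record for X2 with X2a in this form**: `X2.Target` from the inputs of
`targetA_of_inputs` and the two typed missing inputs of the CONSTRUCTION-SHAPED sub-cells X2b
(Mazur's main conjecture at the pair) and X2c (the rank-one `p`-part output) — the shape of
`X2.RankZero.target_of_published_of_missingInputs` with `lambdaMu_multiplicative_of_gvPar` replaced
by `hLift`/`hAn` + `hCassels`. [cite: Miller2011LMS, Def. 1.1 and §1] -/
theorem target_of_inputs_of_missingInputs
    (hT : Silverman1994_thmV53_tateUniformisation.{0})
    (hT' : Silverman1994_thmV53_corV54_tateUniformisation.{0})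
    (hA : lambda_nonPrimitive_eq_add_sum_delta_multiplicative)
    (hB : datumSelmer_divisible_of_finite_torsionBy)
    (hF : datumStrictSelmer_lt_datumSelmer_of_split)
    (hG : Greenberg1999.prop510_isTorsion_hasUnitContent_of_gvPar)
    (hLift : ∀ (W : WeierstrassCurve ℚ) [W.IsGloballyMinimal] [W.IsElliptic] (p : ℕ) [Fact p.Prime]
      (κ : ZpExtension ℚ p) (S₀ : Finset (HeightOneSpectrum (𝓞 ℚ)))
      (Φ₀ : AddSubgroup (W.geomTorsion (p : ℤ))) (hΦ : IsRationalLine W p Φ₀),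
      p ≠ 2 → κ.IsCyclotomic → ¬ LineUnramifiedAt W p Φ₀ → LineEven W p Φ₀ →
      (∀ v ∈ S₀, ((p : ℕ) : 𝓞 ℚ) ∉ v.asIdeal) →
      (∀ v : HeightOneSpectrum (𝓞 ℚ), v ∉ S₀ → ((p : ℕ) : 𝓞 ℚ) ∉ v.asIdeal →
        W.HasGoodReductionAt v) →
      GVLiftingInput W p κ S₀ Φ₀ hΦ)
    (hAn : ∀ (W : WeierstrassCurve ℚ) [W.IsGloballyMinimal] [W.IsElliptic] (p : ℕ) [Fact p.Prime]
      (κ : ZpExtension ℚ p) {N : ℕ} [NeZero N] (f : CuspForm (Gamma0 N) 2)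
      (S₀ : Finset (HeightOneSpectrum (𝓞 ℚ)))
      (Φ₀ : AddSubgroup (W.geomTorsion (p : ℤ))) (hΦ : IsRationalLine W p Φ₀),
      p ≠ 2 → W.HasMultiplicativeReductionAtPrime p → κ.IsCyclotomic →
      ¬ LineUnramifiedAt W p Φ₀ → LineEven W p Φ₀ → IsNewformOf W f →
      (∀ v ∈ S₀, ((p : ℕ) : 𝓞 ℚ) ∉ v.asIdeal) →
      (∀ v : HeightOneSpectrum (𝓞 ℚ), v ∉ S₀ → ((p : ℕ) : 𝓞 ℚ) ∉ v.asIdeal →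
        W.HasGoodReductionAt v) →
      GVAnalyticInput W p κ f S₀ Φ₀ hΦ)
    (hWu : thm16_charIdeal_dvd_multiplicative_of_reducible)
    (hJs : thm61_splitMultiplicative) (hJn : thm61_nonsplitMultiplicative)
    (hHs : exists_isSplitMultCanonical) (hHn : exists_isMultCanonical)
    (hGZK : rank_eq_analyticRank_of_analyticRank_le_one) (hmod : hasEntireLFunction_rat)
    (hpar : nonempty_modularParametrizationData)
    (hCassels : bsdRHS_eq_of_isIsogenous)
    (hGS : ∀ (W : WeierstrassCurve ℚ) [W.IsElliptic] [W.IsGloballyMinimal] (p : ℕ) [Fact p.Prime],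
      greenberg_stevens (W := W) (p := p))
    (hmissB : ∀ (W : WeierstrassCurve ℚ) [W.IsElliptic] [W.IsGloballyMinimal] (p : ℕ) [Fact p.Prime],
      CellB W p → MissingInputB W p)
    (hmissC : ∀ (W : WeierstrassCurve ℚ) [W.IsElliptic] [W.IsGloballyMinimal] (p : ℕ) [Fact p.Prime],
      CellC W p → MissingInputC W p) :
    Target :=
  target_of_targets
    (targetA_of_inputs hT hT' hA hB hF hG hLift hAn hWu hJs hJn hHs hHn hGZK hmod hpar hCassels hGS)
    (targetB_of_missingInputB hJs hJn hHs hHn hGZK hmod hpar hGS hmissB)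
    (targetC_of_missingInputC hGZK hmissC)

end Summit.BirchSwinnertonDyer.Rank1Residual.X2.GreenbergVatsalTargetAOfInputs

end
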